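import Mathlib
import HarnessLib

/-!
# Carleman's inequality

**Carleman's inequality** (T. Carleman 1923): for every sequence `a₁, a₂, …` of non-negative reals with
`∑ aₙ < ∞`,
`∑_{n ≥ 1} (a₁ a₂ ⋯ aₙ)^{1/n} < e · ∑_{n ≥ 1} aₙ` unless all `aₙ` vanish, and `e` is optimal
[cite: HardyLittlewoodPolya1952, Theorem 334 (§9.12)]; [cite: Steele2004, Problem 2.4, (2.15)].
We formalise **Pólya's proof** (the one printed in both sources): with `c_k = (k+1)^k / k^{k-1}`, so that
`c₁ ⋯ cₙ = (n+1)ⁿ`, the AM–GM inequality gives `(a₁ ⋯ aₙ)^{1/n} ≤ (n(n+1))⁻¹ ∑_{k ≤ n} c_k a_k`, and summing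
with `∑_{n ≥ k} (n(n+1))⁻¹ = 1/k` yields the sharper bound
`∑ₙ (a₁ ⋯ aₙ)^{1/n} ≤ ∑_k (1 + 1/k)^k a_k` [cite: Steele2004, (2.22)], whence Carleman by `(1 + 1/k)^k < e`.

Indexing is shifted to start at `0`: `geomMean a n = (a 0 ⋯ a n)^{1/(n+1)}`, `weight k = (1 + 1/(k+1))^{k+1}`.

* `sum_geomMean_le_sum_weight_mul` — Pólya's finite bound `∑_{n<N} geomMean a n ≤ ∑_{k<N} weight k · a k`;
* `sum_geomMean_le`, `sum_geomMean_lt` — finite sections of Carleman's inequality (strict as soon as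
  some `a k > 0`, `k < N`);
* `summable_geomMean`, `tsum_geomMean_le`, `tsum_geomMean_lt` — **Carleman's inequality** for series.

The optimality of the constant `e` is not formalised.
-/

open Finset Real

noncomputable section

namespace Literature.Analysis.Convex.CarlemanInequality

/-- The geometric mean `(a 0 · a 1 ⋯ a n)^{1/(n+1)}` of the first `n + 1` terms. [folklore] -/
def geomMean (a : ℕ → ℝ) (n : ℕ) : ℝ := (∏ k ∈ range (n + 1), a k) ^ (((n : ℝ) + 1)⁻¹)

/-- Pólya's weight `(1 + 1/(k+1))^{k+1}` (shifted index). [cite: Steele2004, (2.22)] -/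
def weight (k : ℕ) : ℝ := (1 + ((k : ℝ) + 1)⁻¹) ^ (k + 1)

/-- Pólya's coefficient `c_k = (k+1) (1 + 1/(k+1))^{k+1} = (k+2)^{k+1} / (k+1)^k` (shifted index).
[cite: HardyLittlewoodPolya1952, §9.12 proof of Theorem 334] -/
def polyaCoeff (k : ℕ) : ℝ := ((k : ℝ) + 1) * weight k

/-- Geometric means of a non-negative sequence are non-negative. [folklore] -/
private theorem geomMean_nonneg {a : ℕ → ℝ} (ha : ∀ k, 0 ≤ a k) (n : ℕ) : 0 ≤ geomMean a n :=
  rpow_nonneg (prod_nonneg fun k _ => ha k) _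

/-- The Pólya weights are positive. [folklore] -/
private theorem weight_pos (k : ℕ) : 0 < weight k := by unfold weight; positivity

/-- The Pólya coefficients are positive. [folklore] -/
private theorem polyaCoeff_pos (k : ℕ) : 0 < polyaCoeff k := by
  unfold polyaCoeff; exact mul_pos (by positivity) (weight_pos k)

/-- `(1 + 1/(k+1))^{k+1} < e`. [cite: Steele2004, after (2.22)] -/
theorem weight_lt_exp_one (k : ℕ) : weight k < exp 1 := by
  unfold weight
  have hk : (0 : ℝ) < (k : ℝ) + 1 := by positivity
  have h1 : 1 + ((k : ℝ) + 1)⁻¹ < exp (((k : ℝ) + 1)⁻¹) := by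
    have := add_one_lt_exp (x := ((k : ℝ) + 1)⁻¹) (by positivity)
    linarith
  have h2 : (1 + ((k : ℝ) + 1)⁻¹) ^ (k + 1) < exp (((k : ℝ) + 1)⁻¹) ^ (k + 1) :=
    pow_lt_pow_left₀ h1 (by positivity) (Nat.succ_ne_zero k)
  have h3 : exp (((k : ℝ) + 1)⁻¹) ^ (k + 1) = exp 1 := by
    rw [← exp_nat_mul]; congr 1; push_cast; field_simp
  rwa [h3] at h2

/-- `c₀ c₁ ⋯ cₙ = (n+2)^{n+1}` (i.e. `c₁ ⋯ cₙ = (n+1)ⁿ` in the sources' indexing).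
[cite: Steele2004, (2.20)] -/
theorem prod_polyaCoeff (n : ℕ) : ∏ k ∈ range (n + 1), polyaCoeff k = ((n : ℝ) + 2) ^ (n + 1) := by
  induction n with
  | zero => simp [polyaCoeff, weight]; norm_num
  | succ n ih =>
    rw [prod_range_succ, ih]
    unfold polyaCoeff weight
    push_cast
    have h : (n : ℝ) + 1 + 1 = (n : ℝ) + 2 := by ring
    rw [h]
    have hn : ((n : ℝ) + 2) ≠ 0 := by positivity
    rw [show (1 + ((n : ℝ) + 2)⁻¹) = ((n : ℝ) + 3) / ((n : ℝ) + 2) by field_simp; ring, div_pow]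
    field_simp
    ring

/-- **Pólya's AM–GM step**: `(a 0 ⋯ a n)^{1/(n+1)} ≤ ((n+1)(n+2))⁻¹ ∑_{k ≤ n} c_k a_k`.
[cite: HardyLittlewoodPolya1952, §9.12]; [cite: Steele2004, (2.17)–(2.21)] -/
theorem geomMean_le_sum_polyaCoeff_mul {a : ℕ → ℝ} (ha : ∀ k, 0 ≤ a k) (n : ℕ) :
    geomMean a n ≤ (((n : ℝ) + 1) * ((n : ℝ) + 2))⁻¹ * ∑ k ∈ range (n + 1), polyaCoeff k * a k := by
  have hn1 : (0 : ℝ) < (n : ℝ) + 1 := by positivity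
  have hn2 : (0 : ℝ) < (n : ℝ) + 2 := by positivity
  -- AM–GM with equal weights on `c_k a_k`
  have hz : ∀ k ∈ range (n + 1), 0 ≤ polyaCoeff k * a k :=
    fun k _ => mul_nonneg (polyaCoeff_pos k).le (ha k)
  have hw : ∀ k ∈ range (n + 1), (0 : ℝ) ≤ ((n : ℝ) + 1)⁻¹ := fun _ _ => by positivity
  have hw' : ∑ k ∈ range (n + 1), ((n : ℝ) + 1)⁻¹ = 1 := by
    rw [sum_const, card_range, nsmul_eq_mul]; push_cast; field_simp
  have amgm := geom_mean_le_arith_mean_weighted (range (n + 1)) (fun _ => ((n : ℝ) + 1)⁻¹)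
    (fun k => polyaCoeff k * a k) hw hw' hz
  -- the left-hand side is `(n+2) · geomMean a n`
  have hlhs : ∏ k ∈ range (n + 1), (polyaCoeff k * a k) ^ ((n : ℝ) + 1)⁻¹ = ((n : ℝ) + 2) * geomMean a n := by
    rw [finsetProd_rpow _ _ hz, prod_mul_distrib, prod_polyaCoeff,
      mul_rpow (by positivity) (prod_nonneg fun k _ => ha k)]
    congr 1
    have : ((n : ℝ) + 1)⁻¹ = ((n + 1 : ℕ) : ℝ)⁻¹ := by push_cast; ring
    rw [this, pow_rpow_inv_natCast hn2.le (Nat.succ_ne_zero n)]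
  rw [hlhs, ← mul_sum] at amgm
  rw [mul_inv, mul_assoc, le_inv_mul_iff₀ hn1, le_inv_mul_iff₀ hn2]
  have h := (le_inv_mul_iff₀ hn1).mp amgm
  have hcomm : ((n : ℝ) + 2) * (((n : ℝ) + 1) * geomMean a n)
      = ((n : ℝ) + 1) * (((n : ℝ) + 2) * geomMean a n) := by ring
  rw [hcomm]
  exact h

/-- Partial sums with the telescoped tail `∑_{k ≤ n < N} ((n+1)(n+2))⁻¹ = 1/(k+1) - 1/(N+1)`.
[cite: Steele2004, (2.19)] -/
theorem sum_geomMean_le_aux {a : ℕ → ℝ} (ha : ∀ k, 0 ≤ a k) (N : ℕ) :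
    ∑ n ∈ range N, geomMean a n
      ≤ ∑ k ∈ range N, polyaCoeff k * a k * (((k : ℝ) + 1)⁻¹ - ((N : ℝ) + 1)⁻¹) := by
  induction N with
  | zero => simp
  | succ N ih =>
    rw [sum_range_succ, sum_range_succ]
    have hstep := geomMean_le_sum_polyaCoeff_mul ha N
    have hN1 : (0 : ℝ) < (N : ℝ) + 1 := by positivity
    have hN2 : (0 : ℝ) < (N : ℝ) + 2 := by positivity
    -- re-centre the old tail terms from `1/(N+1)` to `1/(N+2)`
    have hkey : ∑ k ∈ range N, polyaCoeff k * a k * (((k : ℝ) + 1)⁻¹ - ((N : ℝ) + 1)⁻¹)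
        + (((N : ℝ) + 1) * ((N : ℝ) + 2))⁻¹ * ∑ k ∈ range (N + 1), polyaCoeff k * a k
        = ∑ k ∈ range N, polyaCoeff k * a k * (((k : ℝ) + 1)⁻¹ - (((N + 1 : ℕ) : ℝ) + 1)⁻¹)
          + polyaCoeff N * a N * (((N : ℝ) + 1)⁻¹ - (((N + 1 : ℕ) : ℝ) + 1)⁻¹) := by
      rw [sum_range_succ, mul_add, mul_sum, ← add_assoc, ← sum_add_distrib]
      push_cast
      have h12 : ((N : ℝ) + 1 + 1) = (N : ℝ) + 2 := by ring
      rw [h12]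
      congr 1
      · refine sum_congr rfl fun k _ => ?_
        field_simp
        ring
      · field_simp
        ring
    linarith [hkey]

/-- **Pólya's sharpening of Carleman's inequality** (finite form):
`∑_{n<N} (a 0 ⋯ a n)^{1/(n+1)} ≤ ∑_{k<N} (1 + 1/(k+1))^{k+1} a k`. [cite: Steele2004, (2.22)];
[cite: HardyLittlewoodPolya1952, §9.12] -/
theorem sum_geomMean_le_sum_weight_mul {a : ℕ → ℝ} (ha : ∀ k, 0 ≤ a k) (N : ℕ) :
    ∑ n ∈ range N, geomMean a n ≤ ∑ k ∈ range N, weight k * a k := by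
  refine (sum_geomMean_le_aux ha N).trans (sum_le_sum fun k _ => ?_)
  have hk : (0 : ℝ) < (k : ℝ) + 1 := by positivity
  have hca : 0 ≤ polyaCoeff k * a k := mul_nonneg (polyaCoeff_pos k).le (ha k)
  calc polyaCoeff k * a k * (((k : ℝ) + 1)⁻¹ - ((N : ℝ) + 1)⁻¹)
      ≤ polyaCoeff k * a k * ((k : ℝ) + 1)⁻¹ :=
        mul_le_mul_of_nonneg_left (by linarith [inv_nonneg.mpr (by positivity : (0:ℝ) ≤ (N:ℝ) + 1)]) hca
    _ = weight k * a k := by unfold polyaCoeff; field_simp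

/-- **Carleman's inequality, finite sections**: `∑_{n<N} (a 0 ⋯ a n)^{1/(n+1)} ≤ e ∑_{k<N} a k`.
[cite: HardyLittlewoodPolya1952, Theorem 334]; [cite: Steele2004, (2.15)] -/
theorem sum_geomMean_le {a : ℕ → ℝ} (ha : ∀ k, 0 ≤ a k) (N : ℕ) :
    ∑ n ∈ range N, geomMean a n ≤ exp 1 * ∑ k ∈ range N, a k := by
  refine (sum_geomMean_le_sum_weight_mul ha N).trans ?_
  rw [mul_sum]
  exact sum_le_sum fun k _ => mul_le_mul_of_nonneg_right (weight_lt_exp_one k).le (ha k)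

/-- **Carleman's inequality, finite sections, strict form**: if some `a k > 0` with `k < N` then
`∑_{n<N} (a 0 ⋯ a n)^{1/(n+1)} < e ∑_{k<N} a k`. [cite: HardyLittlewoodPolya1952, Theorem 334] -/
theorem sum_geomMean_lt {a : ℕ → ℝ} (ha : ∀ k, 0 ≤ a k) {N k₀ : ℕ} (hk₀ : k₀ < N) (hpos : 0 < a k₀) :
    ∑ n ∈ range N, geomMean a n < exp 1 * ∑ k ∈ range N, a k := by
  refine (sum_geomMean_le_sum_weight_mul ha N).trans_lt ?_
  rw [mul_sum]
  exact sum_lt_sum (fun k _ => mul_le_mul_of_nonneg_right (weight_lt_exp_one k).le (ha k))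
    ⟨k₀, mem_range.mpr hk₀, mul_lt_mul_of_pos_right (weight_lt_exp_one k₀) hpos⟩

/-- The geometric means of a summable non-negative sequence are summable.
[cite: HardyLittlewoodPolya1952, Theorem 334] -/
theorem summable_geomMean {a : ℕ → ℝ} (ha : ∀ k, 0 ≤ a k) (hs : Summable a) :
    Summable (geomMean a) := by
  refine summable_of_sum_range_le (geomMean_nonneg ha) (c := exp 1 * ∑' k, a k) fun N => ?_
  refine (sum_geomMean_le ha N).trans ?_
  exact mul_le_mul_of_nonneg_left (hs.sum_le_tsum _ fun k _ => ha k) (exp_pos 1).le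

/-- The Pólya majorant `(1 + 1/(k+1))^{k+1} a k` of a summable non-negative sequence is summable. [folklore] -/
private theorem summable_weight_mul {a : ℕ → ℝ} (ha : ∀ k, 0 ≤ a k) (hs : Summable a) :
    Summable (fun k => weight k * a k) :=
  .of_nonneg_of_le (fun k => mul_nonneg (weight_pos k).le (ha k))
    (fun k => mul_le_mul_of_nonneg_right (weight_lt_exp_one k).le (ha k)) (hs.mul_left _)

/-- **Pólya's sharpening, series form**: `∑ₙ (a 0 ⋯ a n)^{1/(n+1)} ≤ ∑_k (1 + 1/(k+1))^{k+1} a k`.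
[cite: Steele2004, (2.22)] -/
theorem tsum_geomMean_le_tsum_weight_mul {a : ℕ → ℝ} (ha : ∀ k, 0 ≤ a k) (hs : Summable a) :
    ∑' n, geomMean a n ≤ ∑' k, weight k * a k := by
  refine Real.tsum_le_of_sum_range_le (geomMean_nonneg ha) fun N => ?_
  exact (sum_geomMean_le_sum_weight_mul ha N).trans
    ((summable_weight_mul ha hs).sum_le_tsum _ fun k _ => mul_nonneg (weight_pos k).le (ha k))

/-- **Carleman's inequality** (non-strict): `∑ₙ (a 0 ⋯ a n)^{1/(n+1)} ≤ e ∑ₙ a n` for every summable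
non-negative sequence. [cite: HardyLittlewoodPolya1952, Theorem 334]; [cite: Steele2004, (2.15)] -/
theorem tsum_geomMean_le {a : ℕ → ℝ} (ha : ∀ k, 0 ≤ a k) (hs : Summable a) :
    ∑' n, geomMean a n ≤ exp 1 * ∑' k, a k := by
  refine Real.tsum_le_of_sum_range_le (geomMean_nonneg ha) fun N => ?_
  exact (sum_geomMean_le ha N).trans
    (mul_le_mul_of_nonneg_left (hs.sum_le_tsum _ fun k _ => ha k) (exp_pos 1).le)

/-- **Carleman's inequality** (T. Carleman 1923; proof of G. Pólya): for a summable sequence of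
non-negative reals, not all zero, `∑ₙ (a 0 a 1 ⋯ a n)^{1/(n+1)} < e · ∑ₙ a n`.
[cite: HardyLittlewoodPolya1952, Theorem 334 (§9.12)]; [cite: Steele2004, Problem 2.4 (2.15)] -/
theorem tsum_geomMean_lt {a : ℕ → ℝ} (ha : ∀ k, 0 ≤ a k) (hs : Summable a) (hne : ∃ k, 0 < a k) :
    ∑' n, geomMean a n < exp 1 * ∑' k, a k := by
  obtain ⟨k₀, hk₀⟩ := hne
  refine (tsum_geomMean_le_tsum_weight_mul ha hs).trans_lt ?_
  rw [← tsum_mul_left]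
  exact Summable.tsum_lt_tsum_of_nonneg (fun k => mul_nonneg (weight_pos k).le (ha k))
    (fun k => mul_le_mul_of_nonneg_right (weight_lt_exp_one k).le (ha k))
    (mul_lt_mul_of_pos_right (weight_lt_exp_one k₀) hk₀) (hs.mul_left _)

#harness_tags tsum_geomMean_lt

end Literature.Analysis.Convex.CarlemanInequality
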